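import Literature.NumberTheory.EllipticCurves.CanonicalPAdicHeightNumeratorProofs
import Literature.NumberTheory.EllipticCurves.PadicSigmaUniquenessProofs
import Literature.NumberTheory.EllipticCurves.PadicSigmaOddPrime
import HarnessLib

/-!
# The Mazur–Tate sigma function to second order and its Iwasawa logarithm to FIRST order:
# `σ_p(t) = t + (a₁/2)t² + O(t³)` and `log_p σ_p(t) = log_p t + (a₁/2)t + O(t²)` (odd `p`, `p = 3` included)

Sibling proof file of `PadicSigma.lean` / `CanonicalPAdicHeight.lean` (pure proofs: no definitions, no
named facts). The canonical cyclotomic `p`-adic height of the tree is the sigma formula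
`ĥ_p(P) = log_p(den x(P)) - 2 log_p σ_p(z(P))` (`WeierstrassCurve.canonicalPAdicHeight`), `σ_p` THE
Mazur–Tate sigma function of `W ⊗ ℚ_p` (`WeierstrassCurve.padicSigma`, evaluated by `padicSigmaEval`;
junk value `t` when no Mazur–Tate pair exists). Every digit-level computation with `ĥ_p` on a general
(five-coefficient) model starts from the expansion `σ_p(t) = t + (a₁/2)t² + ⋯ ∈ tℤ_p⟦t⟧`
(Mazur–Stein–Tate 2006, Thm. 1.3 and Rem. 1.4; Harvey 2008, §5; at `p = 3` Balakrishnan 2016, §2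
eq. (2.3)). This file proves it, and its logarithmic form, for EVERY prime at which `W ⊗ ℚ_p` has a
Mazur–Tate pair — hypothesis `∃ σ c, (W.baseChange ℚ_[p]).IsMazurTateSigmaPair σ c`, discharged for a
globally minimal `W` at good ordinary `p ≥ 5` by the tree theorem `mazur_tate_sigma_exists_odd_of_five_le`
(Blakestad–Grant 2023) and at every odd good ordinary `p` (`p = 3` included) by the named fact
`mazur_tate_sigma_exists_odd` (Mazur–Tate 1991 Thm. 3.1 as printed for odd `p`; its only new content is
`p = 3`, `mazur_tate_sigma_exists_odd_iff_three`). The Summits-side stub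
`Summit.…Cruxes.PAdicOrderThesisR2.WieferichJet.stub_sigmaJet` is the `p ≥ 5` case of the jet estimate;
it is re-proved here in Literature generality (a Literature file cannot import it).

* `Literature.….norm_padicLog_one_add_sub_le` — `p` odd, `‖z‖ < 1`: `‖log_p(1+z) - z‖ ≤ ‖z‖²`;
  `norm_padicLog_eq_norm_one_sub` — `‖log_p y‖ = ‖1 - y‖` on principal units;
  `norm_padicLog_sub_div_le` — for a unit `u`: `‖log_p u - (u^{p-1} - 1)/(p-1)‖ ≤ ‖u^{p-1} - 1‖²`
  (at `p = 3`: `log₃ u ≡ (u² - 1)/2 (mod 9)`);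
* `WeierstrassCurve.coeff_two_padicSigma_eq_of_exists_pair` — `c₂ = a₁/2`
  (`IsMazurTateSigmaPair.two_mul_coeff_two`, oddness); `norm_padicSigmaEval_sub_sub_le` —
  **`‖σ_p(t) - t - (a₁/2)t²‖ ≤ ‖t‖³`** for `‖t‖ < 1` (any `p`); `norm_padicSigmaEval_sub_self_le_sq` —
  `‖σ_p(t) - t‖ ≤ ‖t‖²` unconditionally;
* `WeierstrassCurve.norm_padicLog_padicSigmaEval_sub_le` — `p` odd, `0 < ‖t‖ < 1`:
  **`‖log_p σ_p(t) - log_p t - (a₁/2)·t‖ ≤ ‖t‖²`** (multiplicativity of the Iwasawa logarithm, tree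
  theorem `padicLog_mul_holds`); `…_of_five_le` (unconditional) and `…_of_odd` (under
  `mazur_tate_sigma_exists_odd`) in the shape `W` globally minimal, `p` good ordinary, `‖t‖ ≤ p⁻¹`.

The consequences for `ĥ_p` (first-order height formula, the cancellation
`ĥ_p(P) = log_p(num x) + O(‖z(P)‖²)` on every model, the first `3`-adic digit of `ĥ₃(P)`) are in
`CanonicalPAdicHeightFirstOrderProofs.lean`.

## References

* [MazurSteinTate2006] B. Mazur, W. Stein, J. Tate, Doc. Math. Extra Vol. Coates (2006), §1
  eq. (1.1), Thm. 1.3 and Rem. 1.4 (`σ(t) = t + (a₁/2)t² + ⋯ ∈ tℤ_p⟦t⟧`, "`p` an odd prime").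
* [Harvey2008] D. Harvey, LMS J. Comput. Math. 11 (2008) (arXiv:0708.3404), §5, Lemma 8
  (`log_p u mod p^N` depends only on `u mod p^N`).
* [Balakrishnan2016] J. S. Balakrishnan, J. Number Theory 161 (2016), §2 eq. (2.3) (`p = 3`).
* [Iwasawa1972PadicL] K. Iwasawa, *Lectures on `p`-adic `L`-functions*, §4.4 (`log_p`).

## Design

The pair hypothesis is a plain `∃` over the tree's structure `IsMazurTateSigmaPair` (core theorems
unconditional); the named fact enters only `…_of_odd`. No integrality of `W` is needed in this file
(`a₁/2 ∈ ℤ_p` is a CONSEQUENCE of the pair's integrality). Declarations about `σ_p` sit in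
`namespace WeierstrassCurve` as dot-notation companions of `WeierstrassCurve.padicSigmaEval` (as in
`CanonicalPAdicHeightNumeratorProofs.lean`); the lemmas about `log_p` alone are in
`Literature.NumberTheory.EllipticCurves`, next to `padicLog`.
-/

noncomputable section

open scoped Classical
open PowerSeries Literature.NumberTheory.EllipticCurves

/-! ### The Iwasawa logarithm near `1` and on units, to first order (odd `p`) -/

namespace Literature.NumberTheory.EllipticCurves

variable {p : ℕ} [Fact p.Prime]

/-- `‖2‖_p = 1` for odd `p`. [folklore] -/
private theorem norm_two_eq_one_of_ne_two (hp : p ≠ 2) : ‖(2 : ℚ_[p])‖ = 1 := by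
  rw [show (2 : ℚ_[p]) = ((2 : ℕ) : ℚ_[p]) by norm_cast, Padic.norm_natCast_eq_one_iff]
  exact ((Nat.coprime_primes Nat.prime_two (Fact.out : p.Prime)).mpr (Ne.symm hp)).symm

/-- **`log_p(1 + z) = z + O(z²)`**: for `p` odd and `‖z‖_p < 1`, `‖log_p(1+z) - z‖_p ≤ ‖z‖_p²`
(`log_p = L` on principal units, `padicLog_eq_padicLogSeries`; tail estimate
`norm_padicLogSeries_add_le`; `‖1/2‖_p = 1`). [Iwasawa 1972, §4.4 (the logarithmic series); Harvey
2008, Lemma 8] [cite: Iwasawa1972PadicL, §4.4] -/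
theorem norm_padicLog_one_add_sub_le (hp : p ≠ 2) {z : ℚ_[p]} (hz : ‖z‖ < 1) :
    ‖padicLog p (1 + z) - z‖ ≤ ‖z‖ ^ 2 := by
  have h1 : ‖1 - (1 + z)‖ < 1 := by rwa [sub_add_cancel_left, norm_neg]
  have h := norm_padicLogSeries_add_le h1
  rw [sub_add_cancel_left, norm_neg, norm_inv, norm_two_eq_one_of_ne_two hp, inv_one, mul_one,
    ← sub_eq_add_neg] at h
  rwa [padicLog_eq_padicLogSeries h1]

/-- `‖log_p y‖ = ‖1 - y‖` for `‖1 - y‖ < 1`, `p` odd (`log_p` is an isometry on `1 + pℤ_p`).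
[Iwasawa 1972, §4.4 (`log_p` is an isometry on `1 + 2pℤ_p`)] [cite: Iwasawa1972PadicL, §4.4] -/
theorem norm_padicLog_eq_norm_one_sub (hp : p ≠ 2) {y : ℚ_[p]} (hy : ‖1 - y‖ < 1) :
    ‖padicLog p y‖ = ‖1 - y‖ := by
  rw [padicLog_eq_padicLogSeries hy]
  exact norm_padicLogSeries_eq (by rwa [norm_two_eq_one_of_ne_two hp])

/-- **The Iwasawa logarithm of a unit, to first order**: for `p` odd and `‖u‖_p = 1`,
`‖log_p u - (u^{p-1} - 1)/(p - 1)‖_p ≤ ‖u^{p-1} - 1‖_p²` (`log_p u = (p-1)⁻¹ log_p(u^{p-1})`,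
`u^{p-1}` a principal unit by Fermat, `padicLog_of_ne_zero`; then `norm_padicLog_one_add_sub_le`;
`p - 1` is a `p`-adic unit). At `p = 3`: `‖log₃ u - (u² - 1)/2‖₃ ≤ ‖u² - 1‖₃² ≤ 3⁻²`.
[Iwasawa 1972, §4.4 (`log_p x = (p-1)⁻¹ log_p x^{p-1}` on units); Harvey 2008, Lemma 8]
[cite: Iwasawa1972PadicL, §4.4] -/
theorem norm_padicLog_sub_div_le (hp : p ≠ 2) {u : ℚ_[p]} (hu : ‖u‖ = 1) :
    ‖padicLog p u - (u ^ (p - 1) - 1) / ((p : ℚ_[p]) - 1)‖ ≤ ‖u ^ (p - 1) - 1‖ ^ 2 := by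
  have hP : p.Prime := Fact.out
  have hu0 : u ≠ 0 := norm_pos_iff.mp (by rw [hu]; exact one_pos)
  have hv : u.valuation = 0 := valuation_eq_of_norm_eq hu0 (n := 0) (by simpa using hu)
  have hy : ‖1 - u ^ (p - 1)‖ < 1 := norm_one_sub_pow_sub_one_lt hu
  have hn1 : ‖(p : ℚ_[p]) - 1‖ = 1 := by
    have hpn : ‖(p : ℚ_[p])‖ < 1 := by
      rw [Padic.norm_p]; exact inv_lt_one_of_one_lt₀ (by exact_mod_cast hP.one_lt)
    rw [norm_sub_rev]
    exact norm_eq_one_of_norm_one_sub_lt (by rwa [sub_sub_cancel])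
  have hlog : padicLog p u = ((p : ℚ_[p]) - 1)⁻¹ * padicLog p (u ^ (p - 1)) := by
    rw [padicLog_of_ne_zero hu0, hv, neg_zero, zpow_zero, mul_one, ← padicLog_eq_padicLogSeries hy]
  set y : ℚ_[p] := u ^ (p - 1) with hydef
  have hz : ‖y - 1‖ < 1 := by rwa [norm_sub_rev]
  have key := norm_padicLog_one_add_sub_le hp hz
  rw [add_sub_cancel] at key
  have hrew : padicLog p u - (y - 1) / ((p : ℚ_[p]) - 1) =
      ((p : ℚ_[p]) - 1)⁻¹ * (padicLog p y - (y - 1)) := by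
    rw [hlog, mul_sub, div_eq_mul_inv, mul_comm (y - 1)]
  rw [hrew, norm_mul, norm_inv, hn1, inv_one, one_mul]
  exact key

end Literature.NumberTheory.EllipticCurves

namespace WeierstrassCurve

/-! ### The sigma function to second order: `σ_p(t) = t + (a₁/2)t² + O(t³)` for a genuine pair -/

section Sigma

variable {p : ℕ} [Fact p.Prime] (W : WeierstrassCurve ℚ)

/-- **`c₂ = a₁/2`** for the canonical sigma function of `W ⊗ ℚ_p` as soon as a Mazur–Tate pair EXISTS
(then `(padicSigma, padicSigmaConst)` is a pair, `isMazurTateSigmaPair_padicSigma`, and oddness forces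
`2c₂ = a₁`, `IsMazurTateSigmaPair.two_mul_coeff_two`). Any prime `p`.
[Mazur–Stein–Tate 2006, Thm. 1.3 and Rem. 1.4] [cite: MazurSteinTate2006, Thm. 1.3] -/
theorem coeff_two_padicSigma_eq_of_exists_pair
    (hσ : ∃ σ : ℚ_[p]⟦X⟧, ∃ c : ℚ_[p], (W.baseChange ℚ_[p]).IsMazurTateSigmaPair σ c) :
    coeff 2 (W.baseChange ℚ_[p]).padicSigma = (W.a₁ : ℚ_[p]) / 2 := by
  have h2 := ((W.baseChange ℚ_[p]).isMazurTateSigmaPair_padicSigma hσ).two_mul_coeff_two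
  have ha : (W.baseChange ℚ_[p]).a₁ = (W.a₁ : ℚ_[p]) := by
    simp [WeierstrassCurve.baseChange, WeierstrassCurve.map_a₁]
  rw [ha] at h2
  rw [eq_div_iff two_ne_zero, mul_comm]
  exact h2

/-- **The tail of the sigma series**: with a Mazur–Tate pair, for `‖t‖ < 1`,
`σ_p(t) - t - (a₁/2)t² = Σ_{n ≥ 0} c_{n+3} t^{n+3}`. [Mazur–Stein–Tate 2006, Thm. 1.3]
[cite: MazurSteinTate2006, Thm. 1.3] -/
theorem padicSigmaEval_sub_sub_eq_tsum_of_exists_pair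
    (hσ : ∃ σ : ℚ_[p]⟦X⟧, ∃ c : ℚ_[p], (W.baseChange ℚ_[p]).IsMazurTateSigmaPair σ c)
    {t : ℚ_[p]} (ht : ‖t‖ < 1) :
    W.padicSigmaEval p t - t - (W.a₁ : ℚ_[p]) / 2 * t ^ 2 =
      ∑' n : ℕ, coeff (n + 3) (W.baseChange ℚ_[p]).padicSigma * t ^ (n + 3) := by
  have hsum := (W.baseChange ℚ_[p]).summable_padicSigma ht
  have hc2 := W.coeff_two_padicSigma_eq_of_exists_pair hσ
  unfold padicSigmaEval
  rw [← hsum.sum_add_tsum_nat_add 3]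
  simp only [Finset.sum_range_succ, Finset.sum_range_zero, zero_add, coeff_zero_padicSigma,
    coeff_one_padicSigma, hc2]
  ring

/-- **`σ_p(t) = t + (a₁/2)t² + O(t³)`**: if `W ⊗ ℚ_p` has a Mazur–Tate pair then for every
`t ∈ ℚ_p` with `‖t‖ < 1`, `‖σ_p(t) - t - (a₁/2)t²‖ ≤ ‖t‖³` (the tail has coefficients in `ℤ_p`,
`norm_coeff_padicSigma_le`; ultrametric inequality for `tsum`). Any prime `p`.
[Mazur–Stein–Tate 2006, Thm. 1.3 and Rem. 1.4] [cite: MazurSteinTate2006, Thm. 1.3] -/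
theorem norm_padicSigmaEval_sub_sub_le
    (hσ : ∃ σ : ℚ_[p]⟦X⟧, ∃ c : ℚ_[p], (W.baseChange ℚ_[p]).IsMazurTateSigmaPair σ c)
    {t : ℚ_[p]} (ht : ‖t‖ < 1) :
    ‖W.padicSigmaEval p t - t - (W.a₁ : ℚ_[p]) / 2 * t ^ 2‖ ≤ ‖t‖ ^ 3 := by
  rw [W.padicSigmaEval_sub_sub_eq_tsum_of_exists_pair hσ ht]
  refine IsUltrametricDist.norm_tsum_le_of_forall_le_of_nonneg (by positivity) fun n => ?_
  rw [norm_mul, norm_pow]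
  calc ‖coeff (n + 3) (W.baseChange ℚ_[p]).padicSigma‖ * ‖t‖ ^ (n + 3)
      ≤ 1 * ‖t‖ ^ (n + 3) := by
        gcongr
        exact norm_coeff_padicSigma_le _ _
    _ ≤ ‖t‖ ^ 3 := by
        rw [one_mul]
        exact pow_le_pow_of_le_one (norm_nonneg t) ht.le (by omega)

/-- `‖σ_p(t) - t‖ ≤ ‖t‖²` for `‖t‖ < 1` (`σ_p ∈ t + t²ℤ_p⟦t⟧`, Mazur–Tate pair or junk value `t`).
[Mazur–Stein–Tate 2006, Thm. 1.3 (`σ(t) = t + ⋯ ∈ tℤ_p⟦t⟧`)] [cite: MazurSteinTate2006, Thm. 1.3] -/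
theorem norm_padicSigmaEval_sub_self_le_sq {t : ℚ_[p]} (ht : ‖t‖ < 1) :
    ‖W.padicSigmaEval p t - t‖ ≤ ‖t‖ ^ 2 := by
  have hsum := (W.baseChange ℚ_[p]).summable_padicSigma ht
  unfold padicSigmaEval
  rw [hsum.tsum_eq_zero_add, (summable_nat_add_iff 1 |>.mpr hsum).tsum_eq_zero_add]
  simp only [coeff_zero_padicSigma, zero_mul, zero_add, coeff_one_padicSigma, one_mul, pow_one,
    add_sub_cancel_left]
  have hbound : ∀ n : ℕ, ‖coeff (n + 1 + 1) (W.baseChange ℚ_[p]).padicSigma * t ^ (n + 1 + 1)‖ ≤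
      ‖t‖ ^ 2 := fun n => by
    rw [norm_mul, norm_pow]
    calc ‖coeff (n + 1 + 1) (W.baseChange ℚ_[p]).padicSigma‖ * ‖t‖ ^ (n + 1 + 1)
        ≤ 1 * ‖t‖ ^ (n + 1 + 1) := by
          gcongr; exact norm_coeff_padicSigma_le _ _
      _ ≤ ‖t‖ ^ 2 := by
          rw [one_mul]
          exact pow_le_pow_of_le_one (norm_nonneg t) ht.le (by omega)
  exact IsUltrametricDist.norm_tsum_le_of_forall_le hbound

/-- **`log_p σ_p(t) = log_p t + (a₁/2)t + O(t²)`** (the first-order sigma–log lemma): for `p` odd,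
`W ⊗ ℚ_p` with a Mazur–Tate pair and `0 < ‖t‖ < 1`, `‖log_p σ_p(t) - log_p t - (a₁/2)·t‖ ≤ ‖t‖²`.
Proof: `σ_p(t) = t(1+z)`, `‖z‖ ≤ ‖t‖`, `‖z - (a₁/2)t‖ ≤ ‖t‖²`; `log_p` is multiplicative
(`padicLog_mul_holds`) and `‖log_p(1+z) - z‖ ≤ ‖z‖²`.
[Mazur–Stein–Tate 2006, Thm. 1.3, §1 eq. (1.1); Harvey 2008, §5] [cite: Harvey2008, §5 and Lemma 8] -/
theorem norm_padicLog_padicSigmaEval_sub_le (hp : p ≠ 2)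
    (hσ : ∃ σ : ℚ_[p]⟦X⟧, ∃ c : ℚ_[p], (W.baseChange ℚ_[p]).IsMazurTateSigmaPair σ c)
    {t : ℚ_[p]} (ht0 : t ≠ 0) (ht : ‖t‖ < 1) :
    ‖padicLog p (W.padicSigmaEval p t) - padicLog p t - (W.a₁ : ℚ_[p]) / 2 * t‖ ≤ ‖t‖ ^ 2 := by
  set σ : ℚ_[p] := W.padicSigmaEval p t with hσdef
  have htpos : 0 < ‖t‖ := norm_pos_iff.mpr ht0
  set z : ℚ_[p] := σ / t - 1 with hzdef
  have hσz : σ = t * (1 + z) := by rw [hzdef, add_sub_cancel, mul_div_cancel₀ _ ht0]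
  have hz_eq : z = (σ - t) / t := by rw [hzdef, sub_div, div_self ht0]
  have hz_le : ‖z‖ ≤ ‖t‖ := by
    rw [hz_eq, norm_div, div_le_iff₀ htpos, ← sq]
    exact W.norm_padicSigmaEval_sub_self_le_sq ht
  have hz1 : ‖z‖ < 1 := hz_le.trans_lt ht
  have h1z0 : 1 + z ≠ 0 := by
    intro h0
    have : ‖1 - (1 + z)‖ < 1 := by rwa [sub_add_cancel_left, norm_neg]
    rw [h0, sub_zero, norm_one] at this
    exact lt_irrefl _ this
  have hz2 : ‖z - (W.a₁ : ℚ_[p]) / 2 * t‖ ≤ ‖t‖ ^ 2 := by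
    have : z - (W.a₁ : ℚ_[p]) / 2 * t = (σ - t - (W.a₁ : ℚ_[p]) / 2 * t ^ 2) / t := by
      rw [hz_eq]; field_simp
    rw [this, norm_div, div_le_iff₀ htpos, show ‖t‖ ^ 2 * ‖t‖ = ‖t‖ ^ 3 by ring]
    exact W.norm_padicSigmaEval_sub_sub_le hσ ht
  have hlog : padicLog p σ = padicLog p t + padicLog p (1 + z) := by
    rw [hσz, padicLog_mul_holds p ht0 h1z0]
  have hsplit : padicLog p σ - padicLog p t - (W.a₁ : ℚ_[p]) / 2 * t =
      (padicLog p (1 + z) - z) + (z - (W.a₁ : ℚ_[p]) / 2 * t) := by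
    rw [hlog]; ring
  rw [hsplit]
  refine (IsUltrametricDist.norm_add_le_max _ _).trans (max_le ?_ hz2)
  exact (norm_padicLog_one_add_sub_le hp hz1).trans (pow_le_pow_left₀ (norm_nonneg _) hz_le 2)

end Sigma

/-! ### Under the sigma-existence theorems / facts (globally minimal `W`, good ordinary `p`) -/

section Facts

variable {p : ℕ} [Fact p.Prime] (W : WeierstrassCurve ℚ) [W.IsElliptic] [W.IsGloballyMinimal]

/-- **The sigma–log lemma at a good ordinary `p ≥ 5`** (unconditional: the pair exists by the tree
theorem `mazur_tate_sigma_exists_odd_of_five_le`): for `t ≠ 0` with `‖t‖ ≤ p⁻¹`,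
`‖log_p σ_p(t) - log_p t - (a₁/2)t‖ ≤ ‖t‖²`. [Mazur–Stein–Tate 2006, Thm. 1.3; Harvey 2008, §5]
[cite: Harvey2008, §5 and Lemma 8] -/
theorem norm_padicLog_padicSigmaEval_sub_le_of_five_le (hp5 : 5 ≤ p)
    (hgood : W.HasGoodReductionAtPrime p) (hord : ¬ (p : ℤ) ∣ W.frobeniusTrace p)
    (t : ℚ_[p]) (ht0 : t ≠ 0) (ht : ‖t‖ ≤ (p : ℝ)⁻¹) :
    ‖padicLog p (W.padicSigmaEval p t) - padicLog p t - (W.a₁ : ℚ_[p]) / 2 * t‖ ≤ ‖t‖ ^ 2 :=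
  W.norm_padicLog_padicSigmaEval_sub_le (by omega)
    (mazur_tate_sigma_exists_odd_of_five_le W p hp5 hgood hord) ht0
    (ht.trans_lt (inv_lt_one_of_one_lt₀ (by exact_mod_cast (Fact.out : p.Prime).one_lt)))

/-- **The sigma–log lemma at an odd good ordinary prime, `p = 3` included**, under the named fact
`mazur_tate_sigma_exists_odd` (Mazur–Tate 1991 Thm. 3.1 / Balakrishnan 2016 (2.3); only new content
`p = 3`): for `t ≠ 0`, `‖t‖ ≤ p⁻¹`: `‖log_p σ_p(t) - log_p t - (a₁/2)t‖ ≤ ‖t‖²`. CONDITIONAL on that fact.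
[Mazur–Stein–Tate 2006, Thm. 1.3; Balakrishnan 2016, §2 eq. (2.3)] [cite: Balakrishnan2016, §2 eq. (2.3)] -/
theorem norm_padicLog_padicSigmaEval_sub_le_of_odd (hex : mazur_tate_sigma_exists_odd) (hp : p ≠ 2)
    (hgood : W.HasGoodReductionAtPrime p) (hord : ¬ (p : ℤ) ∣ W.frobeniusTrace p)
    (t : ℚ_[p]) (ht0 : t ≠ 0) (ht : ‖t‖ ≤ (p : ℝ)⁻¹) :
    ‖padicLog p (W.padicSigmaEval p t) - padicLog p t - (W.a₁ : ℚ_[p]) / 2 * t‖ ≤ ‖t‖ ^ 2 :=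
  W.norm_padicLog_padicSigmaEval_sub_le hp (hex W p hp hgood hord) ht0
    (ht.trans_lt (inv_lt_one_of_one_lt₀ (by exact_mod_cast (Fact.out : p.Prime).one_lt)))


end Facts

end WeierstrassCurve

end
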